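/-
Copyright: statement-level skeleton of a published paper (lit-balaban cell, Phase-2 proof seat p25, gen 19). No proof
claims beyond what the kernel checks below.
-/
import Literature.MathematicalPhysics.QuantumFieldTheory.BalabanImbrieJaffe1984to88.BIJ88WalkRemainderActivity312

/-!
# `BalabanImbrieJaffe1984to88.BIJ88WalkRemainderExpectation312` — T. Bałaban, J. Imbrie, A. Jaffe, *Effective action and
cluster properties of the abelian Higgs model*, Commun. Math. Phys. **114** (1988) 257–315 [BalabanImbrieJaffe1988],
§5.14 p. 312 [PDF 56], verbatim: *"Summing all terms in X_r gives an observable F_{k,rem}(X_r)."*, *"By performing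
sufficiently many integrations by parts, we have arranged for enough small factors to beat these large factors in the
remainder terms (at least if X_{r′} is not at the boundary of Λ₁₂^{(k)})."*, and p. 309 [PDF 53]: *"Each t-derivative
of a χ-factor in χ_{Λ₁₂^{(k)},t} gives at least a factor e^β(L^kε/ε₀)^{1/4−α}."* — **THE EXPECTATION HYPOTHESIS OF THE LOCALIZED
REMAINDER BOUND, REDUCED TO A SUP BOUND ON THE CUTOFF'S DERIVATIVES AND A MOMENT BOUND** (p25 gen 19): the sibling
`BIJ88WalkRemainderActivity312.abs_remAt_div_le` takes `|𝔼_W[Π_{legs}Φ·(Π_{dirs}∂)χ·e^{−V}]| ≤ K_χ·Π_{z∈dirs}(η_χ‖z‖)·Λ`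
as a hypothesis; here it is DERIVED (`remainder_expectation_le`) from (i) a pointwise bound on the cutoff's
directional derivatives times the interaction factor, `|(Π_{z∈D}∂_z)χ·e^{−V}| ≤ K_χ·Π_{z∈D}(η_χ‖z‖)` (each derivative
costs `η_χ` times the direction's norm), and (ii) a moment bound on the law, `𝔼_W|Π_{legs}Φ| ≤ Λ`, via the
elementary `|𝔼_W[F·H]| ≤ sup|H|·𝔼_W|F|` for the monomials `F` of the pending legs (`abs_integral_fieldLaw_le_sup`);
whence the localized remainder bound under (i), (ii) (`abs_remAt_div_le_of_sup`).

statement-level skeleton of published theorems with citation tags; proofs where landed; nothing here is a claim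
about the Yang–Mills mass gap

PDF held: `paper:balaban1988-cmp114-bij-abelian-higgs-effective-action` (journal page = PDF page + 256); p. 309, 312 =
PDF 53, 56 (`p0053.txt` L21–22, `p0056.txt` L5, L23–25 re-read this session, 2026-08-23).

CITATION HEADER (lean-in-tree rule).  lit-balaban cell (HOME `run/shared/lean/pub/lit-balaban/`), Phase 2, seat p25
gen 19; row **C2.Claim@312** of `HOME/lit-balaban-r16/ROWS-C2-part2.md` (owner r16, referee ref-5; head
`BIJ88Sect5StatementsPart4.Ineq312` untouched here — MEMBER of the row).  USED BY NAME, nothing restated: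
`BIJ88WalkRemainderActivity312.abs_remAt_div_le` (p25 gen 19), `BIJ88VertexIbp311.{lmono, vexp, integrable_lmono,
continuous_vexp}` (p25 gen 15), `BIJ88SlotMomentsGauss308.{fieldLaw, integral_fieldLaw, integral_density_pos}` (p36),
`B2Eq228Conditioning.{weight, source, weight_pos, source_pos}`, `BIJ88WickDerivatives305.dlist`.

## What is proved (0 `sorry`, standard axioms, no new `Prop` facts; theorems only)

* `abs_integral_lmono_mul_le` (Lebesgue form), **`abs_integral_fieldLaw_le_sup`** (`|𝔼_W[Π_PΦ·H]| ≤ K·𝔼_W|Π_PΦ|` for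
  continuous `|H| ≤ K`), **`remainder_expectation_le`** (the hypothesis `hE` of the sibling from (i), (ii)),
  **`abs_remAt_div_le_of_sup`**.
HONEST SCOPE: (i) and (ii) are HYPOTHESES (print's p. 309 mechanism for the `χ′` factor is the Gaussian measure of the
shell where `χ′ ≠ 0`, gen 17–18's `abs_remTerm_le_shell` — a DIFFERENT route to smallness than the sup bound (i); the
moments (ii) of the pending legs on the law are not estimated here); everything else as in the sibling (locality
abstract, contraction-graph components, no final cluster expansion, no `Ineq312` binder).  NOT summit progress; NOT
continuum; NOT Clay.  Imports `BIJ88WalkRemainderActivity312`; modifies nothing.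
-/

noncomputable section

namespace Literature.MathematicalPhysics.QuantumFieldTheory.BalabanImbrieJaffe1984to88.BIJ88WalkRemainderExpectation312

open Classical MeasureTheory Matrix Finset Filter
open scoped BigOperators
open Literature.MathematicalPhysics.QuantumFieldTheory.Balaban1983to89
open B2Eq228Conditioning (weight source weight_pos source_pos)
open BIJ88PolymerRep5134 (corner)
open BIJ88PolymerRep5134Gauss (prec src)
open BIJ88SlotMomentsGauss308 (fieldLaw integral_fieldLaw integral_density_pos)
open BIJ88VertexIbp311 (lmono vexp integrable_lmono continuous_vexp)
open BIJ88WickDerivatives305 (dlist)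
open BIJ88VertexComponents311 (maxArity)
open BIJ88WalkRun311 BIJ88WalkExpansion311 BIJ88WalkRemainderActivity312

/-! ## §1  `|𝔼[F·H]| ≤ sup|H|·𝔼|F|` for the leg monomials -/

section Lebesgue

variable {S : Type} [Fintype S] [DecidableEq S]

/-- **Lebesgue form**: for `A ≻ 0`, a continuous factor `|H| ≤ K` and a list of legs `L`,
`|∫ Π_LΦ·H·(weight·source)| ≤ K·∫ |Π_LΦ|·(weight·source)`. [cite: BalabanImbrieJaffe1988, §5.14 p.312] -/
theorem abs_integral_lmono_mul_le {A : Matrix S S ℝ} (hA : A.PosDef) (f : S → ℝ) {H : (S → ℝ) → ℝ}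
    (hHc : Continuous H) {K : ℝ} (hK : ∀ φ, |H φ| ≤ K) (L : List (S → ℝ)) :
    |∫ φ, lmono L φ * H φ * (weight A φ * source f φ)| ≤ K * ∫ φ, |lmono L φ| * (weight A φ * source f φ) := by
  have hK' : ∀ φ, ‖H φ‖ ≤ K := fun φ => by rw [Real.norm_eq_abs]; exact hK φ
  have hws : ∀ φ, 0 < weight A φ * source f φ := fun φ => mul_pos (weight_pos A φ) (source_pos f φ)
  -- integrability of both sides
  have hI : Integrable fun φ : S → ℝ => lmono L φ * H φ * (weight A φ * source f φ) := integrable_lmono hA f hHc hK' L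
  have hI1 : Integrable fun φ : S → ℝ => lmono L φ * 1 * (weight A φ * source f φ) :=
    integrable_lmono hA f continuous_const (K := 1) (fun φ => by simp) L
  have hIabs : Integrable fun φ : S → ℝ => |lmono L φ| * (weight A φ * source f φ) := by
    refine hI1.abs.congr (Eventually.of_forall fun φ => ?_)
    dsimp only
    rw [mul_one, abs_mul, abs_of_pos (hws φ)]
  calc |∫ φ, lmono L φ * H φ * (weight A φ * source f φ)|
      ≤ ∫ φ, |lmono L φ * H φ * (weight A φ * source f φ)| := abs_integral_le_integral_abs
    _ ≤ ∫ φ, K * (|lmono L φ| * (weight A φ * source f φ)) := by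
        refine integral_mono hI.abs (hIabs.const_mul K) fun φ => ?_
        dsimp only
        rw [abs_mul, abs_mul, abs_of_pos (hws φ)]
        calc |lmono L φ| * |H φ| * (weight A φ * source f φ)
            ≤ |lmono L φ| * K * (weight A φ * source f φ) :=
              mul_le_mul_of_nonneg_right (mul_le_mul_of_nonneg_left (hK φ) (abs_nonneg _)) (hws φ).le
          _ = K * (|lmono L φ| * (weight A φ * source f φ)) := by ring
    _ = K * ∫ φ, |lmono L φ| * (weight A φ * source f φ) := integral_const_mul _ _

end Lebesgue

/-! ## §2  On the law of the §5.13 model -/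

section Law

variable {ι : Type} [Fintype ι] {κ : Type} [LinearOrder κ] {P : Type} [Fintype P] {β : Type} [DecidableEq β]
variable {α I : Type} [Fintype α] [DecidableEq α] [Fintype I] [DecidableEq I]
  {blk : α → I} {Δ : Matrix α α ℝ} {ℱ : α → ℝ} {W : Finset I}

/-- **`|𝔼_W[Π_PΦ·H]| ≤ K·𝔼_W|Π_PΦ|`** for a continuous factor `|H| ≤ K` and a multiset `P` of legs, on the law of the
fields of `W`. [cite: BalabanImbrieJaffe1988, §5.14 p.312] -/
theorem abs_integral_fieldLaw_le_sup (hPD : (prec blk Δ W (corner ℝ W)).PosDef) {H : ({x : α // blk x ∈ W} → ℝ) → ℝ}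
    (hHc : Continuous H) {K : ℝ} (hK : ∀ φ, |H φ| ≤ K) (P : Multiset ({x : α // blk x ∈ W} → ℝ)) :
    |∫ φ, (P.map fun w => φ ⬝ᵥ w).prod * H φ ∂(fieldLaw blk Δ ℱ W)|
      ≤ K * ∫ φ, |(P.map fun w => φ ⬝ᵥ w).prod| ∂(fieldLaw blk Δ ℱ W) := by
  have hZ := integral_density_pos blk Δ ℱ W hPD
  induction P using Quot.ind with
  | mk L =>
    simp only [Multiset.quot_mk_to_coe'']
    have e : ∀ φ : {x : α // blk x ∈ W} → ℝ, ((L : Multiset _).map fun w => φ ⬝ᵥ w).prod = lmono L φ := fun φ => by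
      simp only [Multiset.map_coe, Multiset.prod_coe]
      rfl
    simp only [e]
    rw [integral_fieldLaw, integral_fieldLaw, abs_div, abs_of_pos hZ, div_le_iff₀ hZ, mul_assoc,
      div_mul_cancel₀ _ hZ.ne']
    exact abs_integral_lmono_mul_le hPD _ hHc hK L

/-- **THE EXPECTATION HYPOTHESIS OF THE LOCALIZED REMAINDER BOUND, DERIVED**: if the cutoff's derivatives times the
interaction factor obey `|(Π_{z∈D}∂_z)χ·e^{−V}|(φ) ≤ K_χ·Π_{z∈D}(η_χ‖z‖)` (every `(Π_D∂)χ` continuous) and the moments of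
the pending legs of the remainder terms of `expand 0 O` obey `𝔼_W|Π_{legs}Φ| ≤ Λ`, then every remainder term satisfies
`|𝔼_W[Π_{legs}Φ·(Π_{dirs t}∂)χ·e^{−V}]| ≤ K_χ·Π_{z∈dirs t}(η_χ‖z‖)·Λ`. [cite: BalabanImbrieJaffe1988, §5.14 p.312] -/
theorem remainder_expectation_le (hPD : (prec blk Δ W (corner ℝ W)).PosDef)
    {Cov : P → Matrix {x : α // blk x ∈ W} {x : α // blk x ∈ W} ℝ} {trig : P → Bool} {c : ι → ℝ}
    {legs : ι → List ({x : α // blk x ∈ W} → ℝ)} {obs : κ → List ({x : α // blk x ∈ W} → ℝ)} {M : ℕ}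
    {χ : ({x : α // blk x ∈ W} → ℝ) → ℝ} {Kχ ηχ Λ : ℝ} (hKχ : 0 ≤ Kχ) (hη0 : 0 ≤ ηχ)
    (hχc : ∀ D : List ({x : α // blk x ∈ W} → ℝ), Continuous (dlist D χ))
    (hK : ∀ (D : List ({x : α // blk x ∈ W} → ℝ)) φ, |dlist D χ φ * vexp c legs φ| ≤ Kχ * (D.map fun z => ηχ * ‖z‖).prod)
    {O : Finset κ}
    (hmom : ∀ t ∈ expand Cov trig (src blk ℱ W) c legs obs M 0 O, t.consts = 0 →
      ∫ φ, |((t.groups.map fun h => (h.pend : Multiset _)).sum.map fun w => φ ⬝ᵥ w).prod| ∂(fieldLaw blk Δ ℱ W) ≤ Λ) :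
    ∀ t ∈ expand Cov trig (src blk ℱ W) c legs obs M 0 O, t.consts = 0 →
      |∫ φ, ((t.groups.map fun h => (h.pend : Multiset _)).sum.map fun w => φ ⬝ᵥ w).prod
          * (dlist t.dirs χ φ * vexp c legs φ) ∂(fieldLaw blk Δ ℱ W)|
        ≤ Kχ * (t.dirs.map fun z => ηχ * ‖z‖).prod * Λ := by
  intro t ht hc
  have hKD : 0 ≤ Kχ * (t.dirs.map fun z => ηχ * ‖z‖).prod :=
    mul_nonneg hKχ (List.prod_nonneg fun x hx => by
      obtain ⟨z, -, rfl⟩ := List.mem_map.1 hx; exact mul_nonneg hη0 (norm_nonneg z))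
  have h := abs_integral_fieldLaw_le_sup (ℱ := ℱ) hPD ((hχc t.dirs).mul (continuous_vexp c legs)) (hK t.dirs)
    ((t.groups.map fun h => (h.pend : Multiset _)).sum)
  exact h.trans (mul_le_mul_of_nonneg_left (hmom t ht hc) hKD)

/-- **THE LOCALIZED REMAINDER BOUND UNDER THE SUP AND MOMENT HYPOTHESES**: `BIJ88WalkRemainderActivity312.abs_remAt_div_le`
with its expectation hypothesis discharged by `remainder_expectation_le`:
`|remAt(O,𝒳)/Z| ≤ K_χ·Λ·W^{Φ₀(O)}·(Π_{j∈O} B_ℓ^{|obs j|})·θ^{nfree 𝒳}·s^{#𝒳}`. [cite: BalabanImbrieJaffe1988, §5.14 p.312] -/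
theorem abs_remAt_div_le_of_sup (hPD : (prec blk Δ W (corner ℝ W)).PosDef)
    {Cov : P → Matrix {x : α // blk x ∈ W} {x : α // blk x ∈ W} ℝ} {trig : P → Bool} {c : ι → ℝ}
    {legs : ι → List ({x : α // blk x ∈ W} → ℝ)} {obs : κ → List ({x : α // blk x ∈ W} → ℝ)} {M : ℕ}
    {χ : ({x : α // blk x ∈ W} → ℝ) → ℝ} {oc : κ → Finset β} {vc : ι → Finset β} {reg : P → Finset β}
    {Dir : Set ({x : α // blk x ∈ W} → ℝ)} {B' ρ : P → ℝ} {cV : ι → ℝ} {Bl θ θv θw ηχ ρ₀ Wc Kχ Λ : ℝ} {N₀ : ℕ}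
    (hθ0 : 0 < θ) (hθ1 : θ ≤ 1) (hBl : 1 ≤ Bl) (hB0 : ∀ p, 0 ≤ B' p) (hρ : ∀ p, 0 ≤ ρ p) (hcV0 : ∀ m, 0 ≤ cV m)
    (hη0 : 0 ≤ ηχ) (hη1 : ηχ ≤ 1) (hθv : 0 < θv) (hθv1 : θv ≤ 1) (hθw : 0 < θw) (hθw1 : θw ≤ 1)
    (hB : ∀ p, ∀ u ∈ Dir, ∀ w ∈ Dir, |(Cov p *ᵥ u) ⬝ᵥ w| ≤ B' p * ρ p)
    (hBf : ∀ p, ∀ u ∈ Dir, |(Cov p *ᵥ u) ⬝ᵥ src blk ℱ W| ≤ B' p * ρ p)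
    (hBz : ∀ p, ∀ u ∈ Dir, ‖Cov p *ᵥ u‖ ≤ B' p * ρ p)
    (hcV : ∀ m, |c m| ≤ cV m) (hobs : ∀ j, ∀ w ∈ obs j, w ∈ Dir) (hlegs : ∀ m, ∀ w ∈ legs m, w ∈ Dir)
    (hloc : ∀ p, trig p = false → B' p ≤ Bl ∧ reg p = ∅) (hwalk : ∀ p, trig p = true → B' p ≤ θw * θ ^ (reg p).card)
    (hvert : ∀ m, cV m * Bl ^ (legs m).length ≤ θv * θ ^ (vc m).card) (hρ₀0 : 0 ≤ ρ₀)
    (hρ₀ : ∀ u ∈ Dir, (∑ p ∈ univ.filter (fun p => Cov p *ᵥ u ≠ 0), ρ p) ≤ ρ₀)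
    (hN : ∀ p, ∀ u ∈ Dir,
      (∑ m, ((range (legs m).length).filter fun j => (Cov p *ᵥ u) ⬝ᵥ (legs m).getD j 0 ≠ 0).card) ≤ N₀)
    (O : Finset κ) (hW1 : 1 ≤ Wc)
    (hW : ρ₀ * ((∑ j ∈ O, ((obs j).length + 1 + M * maxArity legs) + N₀ : ℕ) : ℝ) ≤ Wc)
    (hKχ : 0 ≤ Kχ) (hΛ : 0 ≤ Λ) (hχc : ∀ D : List ({x : α // blk x ∈ W} → ℝ), Continuous (dlist D χ))
    (hK : ∀ (D : List ({x : α // blk x ∈ W} → ℝ)) φ, |dlist D χ φ * vexp c legs φ| ≤ Kχ * (D.map fun z => ηχ * ‖z‖).prod)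
    (hmom : ∀ t ∈ expand Cov trig (src blk ℱ W) c legs obs M 0 O, t.consts = 0 →
      ∫ φ, |((t.groups.map fun h => (h.pend : Multiset _)).sum.map fun w => φ ⬝ᵥ w).prod| ∂(fieldLaw blk Δ ℱ W) ≤ Λ)
    (𝒳 : Multiset (Finset κ × Finset β)) :
    |remAt (prec blk Δ W (corner ℝ W)) Cov trig (src blk ℱ W) c legs obs M χ oc vc reg [] 0 O 𝒳
        / ∫ φ, weight (prec blk Δ W (corner ℝ W)) φ * source (src blk ℱ W) φ|
      ≤ Kχ * Λ * (Wc ^ (∑ j ∈ O, ((obs j).length + 1 + M * maxArity legs)) * ∏ j ∈ O, Bl ^ (obs j).length)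
        * (θ ^ nfreeOf oc 𝒳 * (max ηχ (max (θv ^ M) θw)) ^ Multiset.card 𝒳) :=
  abs_remAt_div_le (χ := χ) hPD hθ0 hθ1 hBl hB0 hρ hcV0 hη0 hη1 hθv hθv1 hθw hθw1 hB hBf hBz hcV hobs hlegs hloc hwalk
    hvert hρ₀0 hρ₀ hN O hW1 hW hKχ hΛ (remainder_expectation_le hPD hKχ hη0 hχc hK hmom) 𝒳

end Law

end Literature.MathematicalPhysics.QuantumFieldTheory.BalabanImbrieJaffe1984to88.BIJ88WalkRemainderExpectation312

end
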